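import Mathlib
import HarnessLib
import Summits.HubbardSuperconductivity.HubbardSuperconductivity.Theorems.KLProgrammeKLRegimeEnginePairTransferBaseScaleZero

/-!
# Route `KLProgramme` — ENGINE child gen 8 (stmt-HubbardSuperconductivity-20437 `KLRegimeEngineV17F2`), skeleton v2 class #5 rev 3, Ẽ-organisation: **`klmg_baseGridNorms_of_scaleZero`**, **`klmf_baseData_of_scaleZero`** — the BASE
# existential of rows 26/26b/51 (`pairTransferStep7_of_analytic(_gridNorms)`, clause `hbase`) CLOSED at scale `0`
# (cell gate-hubbard-kl, seat hubbard-kl-k3c1-p1 g14, technique «composed-map remainder propagation»; companion of `…BaseScaleZero`)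

WHY.  `klmg_memberAmplitude_sub_le_sq` (companion file) closes the member difference at scale `0`: `‖𝒜₀[S_{0,j}](Q;k,k′) − 𝒜₀[S_{0,j′}](Q;k,k′)‖ ≤ (4/6047)·klIdxMass 0 j′·(klTransferC R·U²)`
for `R.WF`, `0 < U ≤ 1`, `FrameOK`, `klBetaMin ≤ β ≤ L`, `β³ ≤ M`, `klScaleZeroThetaC R·U ≤ 1/4`, `j′ ≤ j`.  With the weight-mass row `Σ|t₀[s_j] − t₀[s_j′]| ≤ 4·klIdxMass 0 j′`
(`sum_abs_klTransferWeight_compl_sub_le`) and the bar's floor `r·(KlamU)²·klIdxMass 0 j′ ≤ transferBarRelIdx … 0 j′` (`transferBarRelIdx_floor_le`) this gives the BASE existential from the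
two a priori rows and ONE scalar inequality `(4/6047)·ms·(klTransferC R·U²) + 4·mA²·ms ≤ θ·r·(KlamU)²·ms`, `ms = klIdxMass 0 j′` — i.e. (dividing by `ms > 0`) a condition on the
constants `(R, r, θ, Klam, mA/U)` alone.  Plumbing; nothing else about the model is asserted; nothing asserts (X).3, (c), K3 or superconductivity.  0 kit · 0 lit.
-/

noncomputable section

namespace Summit.HubbardSuperconductivity.HubbardSuperconductivity.Theorems.KLRegimeSplit

set_option linter.dupNamespace false -- summit = problem name (single-conjunct summit), D-0017

open Real Finset Matrix Set Literature.MathematicalPhysics.QuantumLattice Literature.Probability.LatticeModels GrassmannAlgebra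
open Summit.HubbardSuperconductivity.HubbardSuperconductivity.Theorems.KLProgrammeCooperResummation
open Summit.HubbardSuperconductivity.HubbardSuperconductivity.Theorems.KLProgrammeLegKernels
open Summit.HubbardSuperconductivity.HubbardSuperconductivity.Theorems.DispersionFlow
open Summit.HubbardSuperconductivity.HubbardSuperconductivity.Theorems.KLRegimeWick
open Summit.HubbardSuperconductivity.HubbardSuperconductivity.Theorems.EngineV8
open Summit.HubbardSuperconductivity.HubbardSuperconductivity.Theorems.ScaleZeroDecay


/-! ## §5a The member-`j′` carrier's pinned GRID norms, exposed (row 51's `hbase` currency) -/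

section Expose

variable {L M : ℕ} [NeZero L]

set_option maxHeartbeats 800000 in -- the graded-norm construction of k3c2-p1 g5's scale-0 step, inlined
/-- **`klmg_baseGridNorms_of_scaleZero`** — row 51's BASE inputs PRODUCED at scale `0`: for `R.WF`, `0 < U ≤ 1`, `FrameOK R U N μ K`, `klBetaMin ≤ β ≤ L`, `β³ ≤ M`,
`klScaleZeroThetaC R·U ≤ 1/4` and any `j′`, there are pinned GRID kernel norms `NH` of the member-`j′` carrier `e^{Δ_{Sᵀ·softCovOf K s_{0,j′}·S}}·effAction (SᵀC^K_{>e₀}S)(V_N + 𝒩_{K,N})` with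
`(4!/(βL²))·(#legs·Σ_{m′>2} C(2m′,4)·(√(Λ₀·klIdxMass 0 j′))^{2m′−4}·NH(m′)) ≤ (4/6047)·klIdxMass 0 j′·(klTransferC R·U²)` (graded norms of the grid action, first-order binomial with `γ = √6047`,
`klmg_inner_graded_le`, `sum_ite_choose_graded_le`, and the closing arithmetic of `klmg_memberAmplitude_sub_le_sq`). -/
theorem klmg_baseGridNorms_of_scaleZero [NeZero M] {R : RenConsts} (hR : R.WF) {U : ℝ} (hU : 0 < U) (hU1 : U ≤ 1)
    {Nsc : ℕ} {μ : ℝ} {K : TrigPolyC4v} (hK : FrameOK R U Nsc μ K) {β : ℝ} (hβ : klBetaMin ≤ β) (hβL : β ≤ L)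
    (hβM : β ^ 3 ≤ (M : ℝ)) (hθC : klScaleZeroThetaC R * U ≤ 1 / 4) (j' : ℕ) :
    ∃ NH : ℕ → ℝ, (∀ m', 0 ≤ NH m') ∧
      (∀ m' (i : Fin (2 * m')) (w : GridLeg (GridPoint L (2 * (2 * M)))),
        ∑ Y ∈ univ.filter (fun Y : Fin (2 * m') → GridLeg (GridPoint L (2 * (2 * M))) => Y i = w),
          ‖kernel ℂ (gaussConv ℂ ((hubbardGridSub L M β (2 * (2 * M))).transpose * softCovOf L M β μ K (softSymbolCompl L M β μ K 0 j') *
              hubbardGridSub L M β (2 * (2 * M)))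
            (effAction ℂ ((hubbardGridSub L M β (2 * (2 * M))).transpose * hubbardCovAboveCT L M β μ 0 K klE0 * hubbardGridSub L M β (2 * (2 * M)))
              (hubbardGridInteraction L (2 * (2 * M)) β U + hubbardGridCounterQuadratic L (2 * (2 * M)) β K))) (2 * m') Y‖ ≤ NH m') ∧
      ((2 * 2).factorial : ℝ) / (β * (L : ℝ) ^ 2) * (Fintype.card (GridLeg (GridPoint L (2 * (2 * M)))) *
          ∑ m' ∈ range (Fintype.card (GridLeg (GridPoint L (2 * (2 * M)))) / 2 + 1),
            if 2 < m' then ((2 * m').choose (2 * 2) : ℝ) * Real.sqrt (klScale klE0 0 * klIdxMass 0 j') ^ (2 * m' - 2 * 2) * NH m' else 0) ≤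
        4 / 6047 * klIdxMass 0 j' * (klTransferC R * U ^ 2) := by
  -- notation and the closed step data (as in `klmg_memberAmplitude_sub_le_sq`)
  set Ng : ℕ := 2 * (2 * M) with hNg
  haveI : NeZero Ng := ⟨by rw [hNg]; have := NeZero.ne M; omega⟩
  have hβ0 : 0 < β := pos_of_klBetaMin_le hβ
  have hL : (0 : ℝ) < L := by exact_mod_cast Nat.pos_of_ne_zero (NeZero.ne L)
  have hN0 : 0 < ((Ng : ℕ) : ℝ) := by exact_mod_cast Nat.pos_of_ne_zero (NeZero.ne Ng)
  have hUabs : |U| = U := abs_of_pos hU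
  have hU1' : |U| ≤ 1 := by rwa [hUabs]
  have hG0 : 0 ≤ R.Gfr 0 := hR.2.2 0
  set κ₀ : ℝ := Real.sqrt (2 * (7 + 6047)) with hκ₀
  have hκ : 0 < κ₀ := Real.sqrt_pos.2 (by norm_num)
  have hA0 := klScaleZeroA0_pos
  have hCV := klScaleZeroCV_pos hG0
  set S := hubbardGridSub L M β Ng with hS
  set C' := S.transpose * hubbardCovAboveCT L M β μ 0 K klE0 * S with hC'
  have hGB : IsGramBoundedR C' κ₀ := isGramBoundedR_scaleZero_of_frameOK_sharp hK hβ hβL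
  set α : ℝ := ((Ng : ℕ) : ℝ) / β * klScaleZeroA0 with hα
  have hαpos : 0 < α := by positivity
  have hrow : ∀ X, ∑ Y, ‖C' X Y‖ ≤ α := fun X => rowSum_scaleZero_le_A0 (L := L) (μ := μ) hK hβ hβM X
  have hcol : ∀ Y, ∑ X, ‖C' X Y‖ ≤ α := fun Y => colSum_scaleZero_le_A0 (L := L) (μ := μ) hK hβ hβM Y
  set kK : ℝ := klKappaFrameC R * |U| with hkK
  have hkKframe : ∑ z : TorusSite 2 L, ‖framePosKernel L K z‖ ≤ kK :=
    sum_norm_framePosKernel_le_linear_of_frameOK hR hU.ne' hU1' hK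
  set N₁ : ℝ := |β| / Ng * kK with hN₁
  have hkK0 : 0 ≤ kK := by rw [hkK]; exact mul_nonneg (klKappaFrameC_pos hG0).le (abs_nonneg U)
  have hN₁0 : 0 ≤ N₁ := by positivity
  have hct : ∀ (j : Fin 2) (w : GridLeg (GridPoint L Ng)),
      ∑ Y ∈ univ.filter (fun Y : Fin 2 → GridLeg (GridPoint L Ng) => Y j = w),
        ‖kernel ℂ (hubbardGridCounterQuadratic L Ng β K) 2 Y‖ ≤ N₁ := fun j w =>
    (sum_norm_kernel_hubbardGridCounterQuadratic_le_l1 β K j w).trans (mul_le_mul_of_nonneg_left hkKframe (by positivity))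
  set prof : ℕ → ℝ := fun m' : ℕ => if m' = 1 then N₁ else if m' = 2 then |U| * |β| / Ng else 0 with hprof
  set V : ℝ := normV (GridLeg (GridPoint L Ng)) κ₀ κ₀ prof with hV
  have hVeq : V = (Real.exp 2 * (κ₀ + κ₀)) ^ 2 * (|β| / Ng * kK) + (Real.exp 2 * (κ₀ + κ₀)) ^ 4 * (|U| * |β| / Ng) := by
    rw [hV, hprof, hN₁]
    exact normV_scaleZeroPinnedL1_eq four_le_card_gridLeg κ₀ κ₀ β U kK Ng
  have hNV : ((Ng : ℕ) : ℝ) / β * V ≤ klScaleZeroCV R * U := by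
    rw [hVeq, abs_of_pos hβ0, hkK, hUabs, klScaleZeroCV, ← hκ₀, show κ₀ + κ₀ = 2 * κ₀ by ring]
    have h2 : 0 ≤ (Real.exp 2 * (2 * κ₀)) ^ 2 := sq_nonneg _
    have h4 : 0 ≤ (Real.exp 2 * (2 * κ₀)) ^ 4 := by positivity
    have hKC : 0 ≤ klKappaFrameC R := (klKappaFrameC_pos hG0).le
    refine le_of_eq ?_
    field_simp
  have hV0 : 0 ≤ V := by
    rw [hV]; exact normV_nonneg hκ.le hκ.le (klsv_profile_nonneg β U Ng hN₁0)
  set θ : ℝ := Real.exp 1 * α * V / κ₀ ^ 2 with hθdef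
  have hθle : θ ≤ klScaleZeroThetaC R * U := by
    have h1 : θ = Real.exp 1 * klScaleZeroA0 * (((Ng : ℕ) : ℝ) / β * V) / κ₀ ^ 2 := by rw [hθdef, hα]; ring
    rw [h1, klScaleZeroThetaC, ← hκ₀]
    have : Real.exp 1 * klScaleZeroA0 * (((Ng : ℕ) : ℝ) / β * V) ≤ Real.exp 1 * klScaleZeroA0 * (klScaleZeroCV R * U) :=
      mul_le_mul_of_nonneg_left hNV (by positivity)
    calc Real.exp 1 * klScaleZeroA0 * (((Ng : ℕ) : ℝ) / β * V) / κ₀ ^ 2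
        ≤ Real.exp 1 * klScaleZeroA0 * (klScaleZeroCV R * U) / κ₀ ^ 2 := div_le_div_of_nonneg_right this (by positivity)
      _ = _ := by ring
  have hθq : θ ≤ 1 / 4 := hθle.trans hθC
  have hθ0 : 0 ≤ θ := by positivity
  have hθ1 : θ < 1 := by linarith
  set A : ℝ := Real.exp 1 * V / (1 - θ) with hA
  have hAnn : 0 ≤ A := div_nonneg (by positivity) (by linarith)
  -- (1) graded pinned norms of the grid action `F`
  set Vt := hubbardGridInteraction L Ng β U + hubbardGridCounterQuadratic L Ng β K with hVt
  set F := effAction ℂ C' Vt with hF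
  have hVt_even : Vt ∈ evenPart ℂ (GridLeg (GridPoint L Ng)) :=
    add_mem (hubbardGridInteraction_mem_evenPart β U) (hubbardGridCounterQuadratic_mem_evenPart β K)
  have hVt0 : constPart ℂ Vt = 0 := by
    rw [hVt, map_add, constPart_hubbardGridInteraction, constPart_hubbardGridCounterQuadratic, add_zero]
  have hF_even : F ∈ evenPart ℂ (GridLeg (GridPoint L Ng)) := effAction_mem_evenPart C' hVt_even hVt0
  set NF : ℕ → ℝ := fun m' => κ₀⁻¹ ^ (2 * m') * A * θ ^ (m' - 2) with hNF
  have hNF0 : ∀ m', 0 ≤ NF m' := fun m' => by positivity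
  have hNF : ∀ (m' : ℕ) (j : Fin (2 * m')) (w : GridLeg (GridPoint L Ng)),
      ∑ Y ∈ univ.filter (fun Y : Fin (2 * m') → GridLeg (GridPoint L Ng) => Y j = w), ‖kernel ℂ F (2 * m') Y‖ ≤ NF m' := by
    intro m' j w
    rcases Nat.lt_or_ge m' 2 with hm | hm
    · interval_cases m'
      · exact absurd j.2 (by omega)
      · have h := (sum_norm_kernel_effAction_le_of_gramBounded C' hκ hGB Vt hVt_even hVt0 prof (klsv_profile_nonneg β U Ng hN₁0)
          (klsv_sum_norm_kernel_gridVertex_le β U K hN₁0 hct) hαpos hrow hcol hκ hθ1).2 (m := 2 * 1) (by norm_num) j w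
        refine h.trans (le_of_eq ?_)
        simp only [hNF, hA, show (1 : ℕ) - 2 = 0 from rfl, pow_zero, mul_one]
        ring
    · have hdeg : ∀ m'', 2 < m'' → ∀ Y : Fin (2 * m'') → GridLeg (GridPoint L Ng), kernel ℂ Vt (2 * m'') Y = 0 := fun m'' hm'' Y => by
        rw [hVt, kernel_add, kernel_hubbardGridInteraction_of_ne β U (by omega) Y, kernel_hubbardGridCounterQuadratic_of_ne β K (by omega) Y,
          add_zero]
      exact (sum_norm_kernel_effAction_le_pow_of_gramBounded_quartic C' hκ hGB Vt hVt_even hVt0 prof (klsv_profile_nonneg β U Ng hN₁0)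
        (klsv_sum_norm_kernel_gridVertex_le β U K hN₁0 hct) hdeg hαpos hrow hcol hκ hθ1 hm j w).2.trans (le_of_eq (by simp only [hNF, hA]; ring))
  -- (2) the member-`j′` carrier: first-order binomial with `γ = √6047`
  have hγ : 0 ≤ Real.sqrt 6047 := Real.sqrt_nonneg _
  have hGγ : IsGramBoundedR (S.transpose * softCovOf L M β μ K (softSymbolCompl L M β μ K 0 j') * S) (Real.sqrt 6047) :=
    isGramBoundedR_gridSub_softSubCov_zero hK hβ hβL (isSoftSubCov_softCovOf (isSoftSymbol_compl β μ K (Nat.zero_le j')))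
  set NH : ℕ → ℝ := fun m' => ∑ m'' ∈ range (Fintype.card (GridLeg (GridPoint L Ng)) / 2 + 1),
    if m' ≤ m'' then ((2 * m'').choose (2 * m') : ℝ) * Real.sqrt 6047 ^ (2 * m'' - 2 * m') * NF m'' else 0 with hNH
  have hNH0 : ∀ m', 0 ≤ NH m' := fun m' => klmd_binomialProfile_nonneg hγ NF hNF0 _ m'
  refine ⟨NH, hNH0, fun m' i w => klmg_sum_norm_kernel_gaussConv_le_binomial hγ hGγ F hF_even NF hNF0 hNF m' i w, ?_⟩
  -- (3) the two geometric levels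
  have hy : 4 * ((Real.sqrt 6047) ^ 2 * θ * κ₀⁻¹ ^ 2) ≤ 1 / 2 := by
    rw [Real.sq_sqrt (by norm_num), hκ₀, inv_pow, Real.sq_sqrt (by norm_num)]
    nlinarith
  set ms : ℝ := klScale klE0 0 * klIdxMass 0 j' with hms
  have hms0 : 0 ≤ ms := mul_nonneg (klth_klScale_pos 0).le (klIdxMass_nonneg 0 j')
  have hmsE : ms = 1 / 32 * klIdxMass 0 j' := by rw [hms, show klScale klE0 0 = 1 / 32 by simp [klScale, klE0]]
  have hmsb : ms ≤ 15367 / 32 := by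
    have h1 := klIdxMass_le 0 j'
    rw [hmsE]; nlinarith
  have hyD : 4 * ((Real.sqrt ms) ^ 2 * θ * (2 * κ₀⁻¹) ^ 2) ≤ 1 / 2 := by
    rw [Real.sq_sqrt hms0, mul_pow, hκ₀, inv_pow, Real.sq_sqrt (by norm_num)]
    nlinarith [mul_nonneg hms0 hθ0]
  have hinner : ∀ m' : ℕ, 2 < m' → NH m' ≤ (2 * κ₀⁻¹) ^ (2 * m') * (2 * A) * θ ^ (m' - 2) := fun m' hm' => by
    rw [hNH]
    exact klmg_inner_graded_le _ hγ hθ0 (by positivity) hAnn hy hm'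
  have hsum : ∑ m' ∈ range (Fintype.card (GridLeg (GridPoint L Ng)) / 2 + 1),
      (if 2 < m' then ((2 * m').choose (2 * 2) : ℝ) * Real.sqrt ms ^ (2 * m' - 2 * 2) * NH m' else 0) ≤
        80 * (2 * A) * (2 * κ₀⁻¹) ^ 4 * (4 * ((Real.sqrt ms) ^ 2 * θ * (2 * κ₀⁻¹) ^ 2)) := by
    have hle : ∑ m' ∈ range (Fintype.card (GridLeg (GridPoint L Ng)) / 2 + 1),
        (if 2 < m' then ((2 * m').choose (2 * 2) : ℝ) * Real.sqrt ms ^ (2 * m' - 2 * 2) * NH m' else 0) ≤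
        ∑ m' ∈ range (Fintype.card (GridLeg (GridPoint L Ng)) / 2 + 1),
          (if 2 < m' then (((2 * m').choose (2 * 2) : ℕ) : ℝ) * Real.sqrt ms ^ (2 * m' - 2 * 2) * ((2 * κ₀⁻¹) ^ (2 * m') * (2 * A) * θ ^ (m' - 2)) else 0) := by
      refine sum_le_sum fun m' _ => ?_
      split_ifs with hm
      · exact mul_le_mul_of_nonneg_left (hinner m' hm) (by positivity)
      · exact le_rfl
    exact hle.trans (sum_ite_choose_graded_le _ (Real.sqrt_nonneg _) hθ0 (by positivity) (by positivity) hyD)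
  rw [Real.sq_sqrt hms0] at hsum
  -- (4) the closing arithmetic
  rw [card_gridLeg_gridPoint, show ((Nat.factorial (2 * 2) : ℕ) : ℝ) = 24 by norm_num [Nat.factorial]]
  rw [card_gridLeg_gridPoint] at hsum
  have hfrac : θ / (1 - θ) ≤ 4 / 3 * (klScaleZeroThetaC R * U) := by
    rw [div_le_iff₀ (by linarith)]
    nlinarith [mul_nonneg hθ0 (by linarith : (0:ℝ) ≤ klScaleZeroThetaC R * U)]
  have hκ4 : 0 ≤ κ₀⁻¹ ^ 4 := by positivity
  have hκ2 : 0 ≤ κ₀⁻¹ ^ 2 := by positivity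
  have hms' : 0 ≤ klIdxMass 0 j' := klIdxMass_nonneg 0 j'
  calc (24 : ℝ) / (β * (L : ℝ) ^ 2) * (((4 * Ng * L ^ 2 : ℕ) : ℝ) *
        ∑ m' ∈ range (((4 * Ng * L ^ 2 : ℕ)) / 2 + 1), (if 2 < m' then ((2 * m').choose (2 * 2) : ℝ) * Real.sqrt ms ^ (2 * m' - 2 * 2) * NH m' else 0))
      ≤ (24 : ℝ) / (β * (L : ℝ) ^ 2) * (((4 * Ng * L ^ 2 : ℕ) : ℝ) * (80 * (2 * A) * (2 * κ₀⁻¹) ^ 4 * (4 * (ms * θ * (2 * κ₀⁻¹) ^ 2)))) :=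
        mul_le_mul_of_nonneg_left (mul_le_mul_of_nonneg_left hsum (by positivity)) (by positivity)
    _ = 128 * ms * (96 * 80 * 4 * κ₀⁻¹ ^ 4 * κ₀⁻¹ ^ 2 * (Real.exp 1 * (((Ng : ℕ) : ℝ) / β * V)) * (θ / (1 - θ))) := by
        rw [hA]; push_cast; field_simp; ring
    _ ≤ 128 * ms * (96 * 80 * 4 * κ₀⁻¹ ^ 4 * κ₀⁻¹ ^ 2 * (Real.exp 1 * (klScaleZeroCV R * U)) * (4 / 3 * (klScaleZeroThetaC R * U))) := by
        refine mul_le_mul_of_nonneg_left ?_ (by positivity)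
        exact mul_le_mul (mul_le_mul_of_nonneg_left (mul_le_mul_of_nonneg_left hNV (by positivity)) (by positivity)) hfrac
          (div_nonneg hθ0 (by linarith)) (by positivity)
    _ = 4 / 6047 * klIdxMass 0 j' * (klTransferC R * U ^ 2) := by
        rw [klTransferC, ← hκ₀, hmsE]
        field_simp
        ring

end Expose

/-! ## §5 The BASE data, closed -/

section Base

variable (L M : ℕ) [NeZero L] [NeZero M]

/-- **`klmf_baseData_of_scaleZero`** — the BASE existential of rows 26/26b/51 (`pairTransferStep7_of_analytic(_gridNorms)`, clause `hbase`) at the bar `θ·transferBarRelIdx L G P r β U 0 j′`,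
CLOSED at scale `0`: from `R.WF`, `0 < U ≤ 1`, `FrameOK` (bare frame `K₀ = klFlowFrameU … 0`), `klBetaMin ≤ β ≤ L`, `β³ ≤ M`, `klScaleZeroThetaC R·U ≤ 1/4`, `j′ ≤ j`, the two a priori rows and the
ONE scalar inequality `(4/6047)·klIdxMass 0 j′·(klTransferC R·U²) + 4·mA²·klIdxMass 0 j′ ≤ θ·r·(KlamU)²·klIdxMass 0 j′`. -/
theorem klmf_baseData_of_scaleZero {R : RenConsts} (hRw : R.WF) {N₀ : ℕ} {G : GeoConsts} (hCF : 0 ≤ G.CF) {P : SplitConsts} (hKl : 0 ≤ P.Klam) {r : ℝ} (hr : 0 ≤ r)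
    {β U μ : ℝ} (hU : 0 < U) (hU1 : U ≤ 1) {mA θ : ℝ} (hm : 0 ≤ mA) (hθ0 : 0 ≤ θ)
    (hKf : FrameOK R U N₀ μ (klFlowFrameU L M β U μ 0)) (hβ : klBetaMin ≤ β) (hβL : β ≤ L) (hβM : β ^ 3 ≤ (M : ℝ)) (hθC : klScaleZeroThetaC R * U ≤ 1 / 4)
    {j j' : ℕ} (hj : j' ≤ j) (Qm : TorusSite 2 L)
    (hA₁ : ∀ x y, ‖klMemberArrayF L M β U μ 0 (softSymbolCompl L M β μ (klFlowFrameU L M β U μ 0) 0 j) Qm x y‖ ≤ mA)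
    (hA₂ : ∀ x y, ‖klMemberArrayF L M β U μ 0 (softSymbolCompl L M β μ (klFlowFrameU L M β U μ 0) 0 j') Qm x y‖ ≤ mA)
    (hbud : 4 / 6047 * klIdxMass 0 j' * (klTransferC R * U ^ 2) + 4 * (mA * mA) * klIdxMass 0 j' ≤ θ * (r * ((P.Klam * U) ^ 2 * klIdxMass 0 j'))) :
    ∃ η : TorusSite 2 L → TorusSite 2 L → ℝ,
      (∀ x y, ‖klMemberArrayF L M β U μ 0 (softSymbolCompl L M β μ (klFlowFrameU L M β U μ 0) 0 j) Qm x y‖ ≤ mA) ∧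
      (∀ x y, ‖klMemberArrayF L M β U μ 0 (softSymbolCompl L M β μ (klFlowFrameU L M β U μ 0) 0 j') Qm x y‖ ≤ mA) ∧
      (∀ k ∈ klBall L μ 0, ∀ k' ∈ klBall L μ 0,
        ‖(klMemberArrayF L M β U μ 0 (softSymbolCompl L M β μ (klFlowFrameU L M β U μ 0) 0 j) Qm - klMemberArrayF L M β U μ 0 (softSymbolCompl L M β μ (klFlowFrameU L M β U μ 0) 0 j') Qm) k k'‖ ≤ η k k') ∧
      (∀ k ∈ klBall L μ 0, ∀ k' ∈ klBall L μ 0, η k k' + mA * mA *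
        ∑ c, ‖(-(((klTransferWeight L M β μ (klFlowFrameU L M β U μ 0) 0 (softSymbolCompl L M β μ (klFlowFrameU L M β U μ 0) 0 j) Qm c -
          klTransferWeight L M β μ (klFlowFrameU L M β U μ 0) 0 (softSymbolCompl L M β μ (klFlowFrameU L M β U μ 0) 0 j') Qm c : ℝ)) : ℂ))‖ ≤
        θ * transferBarRelIdx L G P r β U 0 j' Qm k k') := by
  refine ⟨fun _ _ => 4 / 6047 * klIdxMass 0 j' * (klTransferC R * U ^ 2), hA₁, hA₂, fun k hk k' hk' => ?_, fun k hk k' hk' => ?_⟩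
  · rw [Matrix.sub_apply, klMemberArrayF_apply_of_mem β U μ 0 _ Qm hk hk', klMemberArrayF_apply_of_mem β U μ 0 _ Qm hk hk']
    exact klmg_memberAmplitude_sub_le_sq (L := L) (M := M) hRw hU hU1 hKf hβ hβL hβM hθC hj Qm k k'
  · have hw : ∑ c, ‖(-(((klTransferWeight L M β μ (klFlowFrameU L M β U μ 0) 0 (softSymbolCompl L M β μ (klFlowFrameU L M β U μ 0) 0 j) Qm c -
          klTransferWeight L M β μ (klFlowFrameU L M β U μ 0) 0 (softSymbolCompl L M β μ (klFlowFrameU L M β U μ 0) 0 j') Qm c : ℝ)) : ℂ))‖ ≤ 4 * klIdxMass 0 j' := by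
      have h := sum_abs_klTransferWeight_compl_sub_le (M := M) β μ (klFlowFrameU L M β U μ 0) hKf hβ hβL (Nat.zero_le j') hj Qm
      refine le_of_eq_of_le ?_ h
      refine Finset.sum_congr rfl fun c _ => ?_
      rw [norm_neg, Complex.norm_real, Real.norm_eq_abs]
    have hfl := transferBarRelIdx_floor_le (L := L) hCF hKl hr β U 0 j' Qm k k'
    rw [klIdxPrefactor_zero, pow_zero, inv_one, one_mul] at hfl
    have hmm : 0 ≤ mA * mA := mul_nonneg hm hm
    have h1 := mul_le_mul_of_nonneg_left hw hmm
    have h2 := mul_le_mul_of_nonneg_left hfl hθ0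
    linarith

end Base

end Summit.HubbardSuperconductivity.HubbardSuperconductivity.Theorems.KLRegimeSplit

end
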